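import Mathlib
import HarnessLib
import Summits.MatrixMultiplication.MatrixMultiplication.Theses.OutsiderSandwich
import Summits.MatrixMultiplication.MatrixMultiplication.Theorems.OutsiderSandwichSpectralTransfer
import Summits.MatrixMultiplication.MatrixMultiplication.Theorems.OutsiderSandwichLaserFloorTop

/-!
# OutsiderSandwich — the Strassen converses: both cruxes of the cut of record are EXACT
# spectral letters (`LaserTangency ⟺ LaserFloorStrict`, `LaserMergeOptimal ⟺ LaserTightAtTop`)

Route `route-MatrixMultiplication-OutsiderSandwich`, cut of record
`closes (h₁ : LaserTangency) (h₂ : LaserMergeOptimal) (h₃ : SummitIffLaserTangency)`.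
The tree already has the easy directions (g11): `strict_of_laserTangency`,
`laserMergeOptimal_of_tightAtTop`, and `ω = 2 ⟺ LaserFloorStrict ∧ LaserTightAtTop`.
This file proves the CONVERSES, so that each crux is individually equivalent — hypothesis-free and
`ω`-free — to a statement about where the compact pair-spectrum
`X = {(τ_F, x_F) : F universal}` (`τ_F = log₂ F⟨2,2,2⟩`, `x_F = log₂ F(cw₂)`) sits relative to the
laser floor line `x = b_L + τ/3`, `b_L = log₂3 − 2/3`.

* `laserTangency_of_strict : LaserFloorStrict → LaserTangency` (§3).  Given `s < 1` put
  `η = 2/s − 2`, let `δ` be Strict's premium, `u = min δ (b_L/2)`.  EVERY universal point then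
  satisfies `(b_L − u) + (1/3 + su/2)·τ_F ≤ x_F` (`pointwise_of_strict`), so the packing
  `⟨2^{β₁}⟩ ⊗ ⟨2^{k₁}⟩³`, `β₁ = ⌊(b_L − u)N₁⌋`, `k₁ = ⌊(1/3 + su/2)N₁⌋`, is spectrally dominated by
  `cw₂^{⊠N₁}`; by Strassen's spectral theorem transported to Kronecker powers of `cw₂`
  (`OutsiderSandwichSpectralTransfer`) its `n`-th power restricts from `cw₂^{⊠(N₁n + r(n))}`,
  `2^{r(n)}` subexponential, and at an `n` with `r(n) ≤ n` this is a tangent packing with cap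
  `b_L − u < b_L` (the slope `su/2` is exactly the `s`-discount of the cap deficit `u`).
* `tightAtTop_of_laserMergeOptimal : LaserMergeOptimal → LaserTightAtTop` (§2).  If TightAtTop
  fails at `δ`, near-top points lie `δ` above the floor and all others have `τ_F < ω − δ`, so
  `σ·τ_F ≤ x_F` with `σ = 1/3 + b_L/ω + κ`, `κ(δ) > 0` (`slope_of_not_tightAtTop`: the merge CHORD
  steepens).  Then `⟨2^{⌊σN⌋}⟩³` is spectrally dominated by `cw₂^{⊠N}`, transfers to restrictions
  `⟨2^{kn}⟩³ ≤ cw₂^{⊠(Nn + r(n))}`, and `LaserMergeOptimal` at `ε = κ` gives, after absorbing the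
  subexponential factor (`IsSubexponential.le_of_pow_le`), `2k ≤ (ℓ+κ)N` against
  `2k > (ℓ+2κ)N − 2` — absurd for `κN ≥ 4`.

Consequently (§4) `LaserTangency ↔ LaserFloorStrict`, `LaserMergeOptimal ↔ LaserTightAtTop`
(item `LaserCutIsSpectral` by name): the cut of record reads, letter for letter,
`ω = 2 ⟺ (X meets the floor line only at the gauge corner (2, log₂3)) ∧ (X meets it at the top
corner τ = max τ)`.

References: Strassen 1988 (J. reine angew. Math. 384, Thm. 3.7), Strassen 1991 (§6),
Coppersmith–Winograd 1990 (§6–7: the laser value `3·2^{(τ−2)/3}` of `cw₂`),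
Bürgisser–Clausen–Shokrollahi 1997 (Ch. 15), Christandl–Vrana–Zuiddam 2023 (universal points),
Wigderson–Zuiddam 2022 (asymptotic spectra notes, Thm. 4.13: rate = min over the spectrum).
-/

-- the problem's namespace `Summit.MatrixMultiplication.MatrixMultiplication` repeats the summit name
set_option linter.dupNamespace false

namespace Summit.MatrixMultiplication.MatrixMultiplication.Theorems.OutsiderSandwichSpectralConverse

open scoped BigOperators Topology
open Filter
open Literature.Computability.AlgebraicComplexity
open Summit.MatrixMultiplication.MatrixMultiplication.Theses.OutsiderSandwich
open Summit.MatrixMultiplication.MatrixMultiplication.Theorems.OutsiderSandwichLaserFloor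
  (two_le_matExp one_le_map_matMulTensor map_matMulTensor_two_pow laserFloor)
open Summit.MatrixMultiplication.MatrixMultiplication.Theorems.OutsiderSandwichLaserFloorCut
  (matExp_le_omega matExp_le_three three_le_map_cwTensor logb_two_three_sub_pos
    strict_of_laserTangency)
open Summit.MatrixMultiplication.MatrixMultiplication.Theorems.OutsiderSandwichLaserFloorTop
  (laserMergeOptimal_of_tightAtTop)
open Summit.MatrixMultiplication.MatrixMultiplication.Theorems.OutsiderSandwichSpectralTransfer
  (map_packing restrictsTo_matMul_of_spectral_le restrictsTo_packing_of_spectral_le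
    exists_le_self_of_isSubexponential logb_two_three_sub_lt exists_level)

/-! ## 1. Values of spectral points as powers of two -/

variable {F : SpectralMap ℂ}

/-- `F⟨2,2,2⟩ = 2^{τ_F}`. -/
theorem map_matMulTensor_two_eq (hF : IsUniversalSpectralPoint ℂ F) :
    F (matMulTensor ℂ 2 2 2) = (2 : ℝ) ^ Real.logb 2 (F (matMulTensor ℂ 2 2 2)) :=
  (Real.rpow_logb two_pos (by norm_num)
    (lt_of_lt_of_le one_pos (one_le_map_matMulTensor hF (by norm_num)))).symm

/-- `F(cw₂) = 2^{x_F}`. -/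
theorem map_cwTensor_eq (hF : IsUniversalSpectralPoint ℂ F) :
    F (cwTensor ℂ 2) = (2 : ℝ) ^ Real.logb 2 (F (cwTensor ℂ 2)) :=
  (Real.rpow_logb two_pos (by norm_num)
    (lt_of_lt_of_le (by norm_num) (three_le_map_cwTensor hF))).symm

/-! ## 2. `LaserMergeOptimal → LaserTightAtTop` -/

/-- **Slope lemma.**  If `LaserTightAtTop` fails with parameter `δ`, the chord slope
`ℓ(ω)/2 = 1/3 + b_L/ω` can be steepened: there is `κ > 0` with `(1/3 + b_L/ω + κ)·τ_F ≤ x_F` for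
EVERY universal spectral point `F`. -/
theorem slope_of_not_tightAtTop {δ : ℝ} (hδ : 0 < δ)
    (hT : ∀ F : SpectralMap ℂ, IsUniversalSpectralPoint ℂ F →
      (∀ G : SpectralMap ℂ, IsUniversalSpectralPoint ℂ G →
        Real.logb 2 (G (matMulTensor ℂ 2 2 2)) ≤ Real.logb 2 (F (matMulTensor ℂ 2 2 2)) + δ) →
      Real.logb 2 3 + (Real.logb 2 (F (matMulTensor ℂ 2 2 2)) - 2) / 3 + δ <
        Real.logb 2 (F (cwTensor ℂ 2))) :
    ∃ κ : ℝ, 0 < κ ∧ κ ≤ 1 / 6 ∧ ∀ F : SpectralMap ℂ, IsUniversalSpectralPoint ℂ F →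
      (1 / 3 + (Real.logb 2 3 - 2 / 3) / omega ℂ + κ) * Real.logb 2 (F (matMulTensor ℂ 2 2 2)) ≤
        Real.logb 2 (F (cwTensor ℂ 2)) := by
  set b := Real.logb 2 3 - 2 / 3 with hb
  have hb0 : 0 < b := logb_two_three_sub_pos
  have hω2 : 2 ≤ omega ℂ := omega_two_le ℂ
  have hω3 : omega ℂ ≤ 3 := omega_le_three' ℂ
  have hω0 : 0 < omega ℂ := by linarith
  have e3 : Real.logb 2 3 = b + 2 / 3 := by rw [hb]; ring
  refine ⟨min (δ / 3) (min (b * δ / 9) (1 / 6)), by positivity,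
    (min_le_right _ _).trans (min_le_right _ _), ?_⟩
  intro F hF
  set κ := min (δ / 3) (min (b * δ / 9) (1 / 6)) with hκ
  have hκ1 : κ ≤ δ / 3 := min_le_left _ _
  have hκ2 : κ ≤ b * δ / 9 := (min_le_right _ _).trans (min_le_left _ _)
  set τ := Real.logb 2 (F (matMulTensor ℂ 2 2 2)) with hτ
  set x := Real.logb 2 (F (cwTensor ℂ 2)) with hx
  have hτ2 : 2 ≤ τ := two_le_matExp hF
  have hτω : τ ≤ omega ℂ := matExp_le_omega hF
  have hτ3 : τ ≤ 3 := matExp_le_three hF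
  have hfloor : Real.logb 2 3 + (τ - 2) / 3 ≤ x := laserFloor hF
  rw [e3] at hfloor
  have hbdiv : b / omega ℂ * τ ≤ b := by
    rw [div_mul_eq_mul_div, div_le_iff₀ hω0]
    exact mul_le_mul_of_nonneg_left hτω hb0.le
  have e1 : (1 / 3 + b / omega ℂ + κ) * τ = τ / 3 + b / omega ℂ * τ + κ * τ := by ring
  rw [e1]
  by_cases hnear : omega ℂ ≤ τ + δ
  · have hlt := hT F hF (fun G hG => (matExp_le_omega hG).trans hnear)
    rw [e3] at hlt
    have hκτ : κ * τ ≤ δ / 3 * 3 := mul_le_mul hκ1 hτ3 (by linarith) (by linarith)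
    linarith
  · push Not at hnear
    have hgap : b / 3 * δ ≤ b / omega ℂ * (omega ℂ - τ) :=
      mul_le_mul (div_le_div_of_nonneg_left hb0.le hω0 hω3) (by linarith) hδ.le (by positivity)
    have hsum : b / omega ℂ * τ + b / omega ℂ * (omega ℂ - τ) = b := by
      rw [← mul_add, show τ + (omega ℂ - τ) = omega ℂ by ring]
      exact div_mul_cancel₀ _ hω0.ne'
    have hκτ : κ * τ ≤ b * δ / 9 * 3 := mul_le_mul hκ2 hτ3 (by linarith) (by positivity)
    linarith

/-- **`LaserMergeOptimal → LaserTightAtTop`** (the converse of the filed edge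
`laserMergeOptimal_of_tightAtTop`).  See the module docstring, §2. -/
theorem tightAtTop_of_laserMergeOptimal (hB : LaserMergeOptimal) : LaserTightAtTop := by
  by_contra hT
  unfold LaserTightAtTop at hT
  push Not at hT
  obtain ⟨δ, hδ, hT⟩ := hT
  obtain ⟨κ, hκ0, hκ6, hslope⟩ := slope_of_not_tightAtTop hδ hT
  have hB' : ∀ ε : ℝ, 0 < ε → ∃ N₀ : ℕ, ∀ N : ℕ, N₀ ≤ N → ∀ m : ℕ,
      TensorRestrictsTo (kroneckerPow (cwTensor ℂ 2) N) (matMulTensor ℂ m m m) →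
        (m : ℝ) ^ 2 ≤ (2 : ℝ) ^ ((2 / 3 + 2 / omega ℂ * (Real.logb 2 3 - 2 / 3) + ε) * N) := hB
  set b := Real.logb 2 3 - 2 / 3 with hb
  have hb0 : 0 < b := logb_two_three_sub_pos
  have hb43 : b < 4 / 3 := logb_two_three_sub_lt
  have hω2 : 2 ≤ omega ℂ := omega_two_le ℂ
  have hω3 : omega ℂ ≤ 3 := omega_le_three' ℂ
  have hω0 : 0 < omega ℂ := by linarith
  set ℓ := 2 / 3 + 2 / omega ℂ * b with hℓ
  have hℓb : 2 / omega ℂ * b ≤ b := by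
    have : 2 / omega ℂ ≤ 1 := by rw [div_le_iff₀ hω0]; linarith
    exact mul_le_of_le_one_left hb0.le this
  have hℓ3 : ℓ + κ ≤ 3 := by rw [hℓ]; linarith
  have hℓ0 : 0 ≤ ℓ := by positivity
  -- the level `N` and the size exponent `k`
  obtain ⟨N₀, hN₀⟩ := hB' κ hκ0
  obtain ⟨N, hNN₀, hN1, hκN⟩ := exists_level N₀ hκ0 4
  set σ := 1 / 3 + b / omega ℂ + κ with hσ
  have hσ0 : 0 ≤ σ := by positivity
  set k := ⌊σ * N⌋₊ with hk
  have hkle : (k : ℝ) ≤ σ * N := Nat.floor_le (by positivity)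
  have hklt : σ * N < k + 1 := Nat.lt_floor_add_one _
  -- spectral domination of `⟨2^k,2^k,2^k⟩` by `cw₂^{⊠N}`
  have hdom : ∀ F : SpectralMap ℂ, IsUniversalSpectralPoint ℂ F →
      F (matMulTensor ℂ (2 ^ k) (2 ^ k) (2 ^ k)) ≤ F (cwTensor ℂ 2) ^ N := by
    intro F hF
    set τ := Real.logb 2 (F (matMulTensor ℂ 2 2 2)) with hτ
    set x := Real.logb 2 (F (cwTensor ℂ 2)) with hx
    have hM : F (matMulTensor ℂ 2 2 2) = (2 : ℝ) ^ τ := map_matMulTensor_two_eq hF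
    have hC : F (cwTensor ℂ 2) = (2 : ℝ) ^ x := map_cwTensor_eq hF
    have hτ0 : 0 ≤ τ := le_trans (by norm_num) (two_le_matExp hF)
    have hsl : σ * τ ≤ x := hslope F hF
    have hexp : τ * k ≤ x * N := by
      calc τ * k ≤ τ * (σ * N) := mul_le_mul_of_nonneg_left hkle hτ0
        _ = σ * τ * N := by ring
        _ ≤ x * N := mul_le_mul_of_nonneg_right hsl (Nat.cast_nonneg N)
    calc F (matMulTensor ℂ (2 ^ k) (2 ^ k) (2 ^ k)) = F (matMulTensor ℂ 2 2 2) ^ k :=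
          map_matMulTensor_two_pow hF k
      _ = (2 : ℝ) ^ (τ * k) := by rw [hM, Real.rpow_mul zero_le_two, Real.rpow_natCast]
      _ ≤ (2 : ℝ) ^ (x * N) := Real.rpow_le_rpow_of_exponent_le one_le_two hexp
      _ = F (cwTensor ℂ 2) ^ N := by rw [hC, Real.rpow_mul zero_le_two, Real.rpow_natCast]
  -- Strassen transfer: `⟨2^{kn}⟩³ ≤ cw₂^{⊠(Nn + r n)}` with `2^{r n}` subexponential
  obtain ⟨r, hr, hres⟩ := restrictsTo_matMul_of_spectral_le k N hdom
  -- `LaserMergeOptimal` along the sequence, subexponential factor split off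
  have hineq : ∀ n : ℕ, 1 ≤ n →
      (((2 : ℝ) ^ k) ^ 2) ^ n ≤ (((2 ^ r n) ^ 3 : ℕ) : ℝ) * ((2 : ℝ) ^ ((ℓ + κ) * N)) ^ n := by
    intro n hn
    have hlev : N₀ ≤ N * n + r n :=
      le_trans hNN₀ (le_trans (Nat.le_mul_of_pos_right N hn) (Nat.le_add_right _ _))
    have h := hN₀ (N * n + r n) hlev (2 ^ (k * n)) (hres n)
    have e1 : (((2 : ℝ) ^ k) ^ 2) ^ n = (((2 ^ (k * n) : ℕ) : ℝ)) ^ 2 := by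
      push_cast
      rw [← pow_mul, ← pow_mul, ← pow_mul]
      congr 1
      ring
    have e2 : (2 : ℝ) ^ ((ℓ + κ) * ((N * n + r n : ℕ) : ℝ)) =
        ((2 : ℝ) ^ ((ℓ + κ) * N)) ^ n * (2 : ℝ) ^ ((ℓ + κ) * r n) := by
      push_cast
      rw [show (ℓ + κ) * ((N : ℝ) * n + r n) = (ℓ + κ) * N * n + (ℓ + κ) * r n by ring,
        Real.rpow_add two_pos, Real.rpow_mul zero_le_two ((ℓ + κ) * N) n, Real.rpow_natCast]
    have e3 : (2 : ℝ) ^ ((ℓ + κ) * r n) ≤ (((2 ^ r n) ^ 3 : ℕ) : ℝ) := by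
      push_cast
      rw [mul_comm, Real.rpow_mul zero_le_two (r n : ℝ) (ℓ + κ), Real.rpow_natCast]
      calc ((2 : ℝ) ^ r n) ^ (ℓ + κ) ≤ ((2 : ℝ) ^ r n) ^ (3 : ℝ) :=
            Real.rpow_le_rpow_of_exponent_le (one_le_pow₀ one_le_two) hℓ3
        _ = ((2 : ℝ) ^ r n) ^ 3 := by
            rw [show (3 : ℝ) = ((3 : ℕ) : ℝ) by norm_num, Real.rpow_natCast]
    rw [e1]
    calc (((2 ^ (k * n) : ℕ) : ℝ)) ^ 2 ≤ _ := h
      _ = _ := e2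
      _ ≤ ((2 : ℝ) ^ ((ℓ + κ) * N)) ^ n * (((2 ^ r n) ^ 3 : ℕ) : ℝ) :=
          mul_le_mul_of_nonneg_left e3 (by positivity)
      _ = (((2 ^ r n) ^ 3 : ℕ) : ℝ) * ((2 : ℝ) ^ ((ℓ + κ) * N)) ^ n := mul_comm _ _
  have hsub : IsSubexponential (fun n => (2 ^ r n) ^ 3) := by
    have h3 := (hr.mul hr).mul hr
    refine IsSubexponential.of_le h3 fun n => ?_
    show (2 ^ r n) ^ 3 ≤ 2 ^ r n * 2 ^ r n * 2 ^ r n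
    exact le_of_eq (by ring)
  have hle : ((2 : ℝ) ^ k) ^ 2 ≤ (2 : ℝ) ^ ((ℓ + κ) * N) :=
    hsub.le_of_pow_le (by positivity) hineq
  -- take logarithms
  have hlog : (2 * k : ℝ) ≤ (ℓ + κ) * N := by
    have h1 : ((2 : ℝ) ^ k) ^ 2 = (2 : ℝ) ^ ((2 * k : ℕ) : ℝ) := by
      rw [Real.rpow_natCast, ← pow_mul, mul_comm]
    rw [h1, Real.rpow_le_rpow_left_iff one_lt_two] at hle
    push_cast at hle
    exact hle
  -- contradiction: `2σN - 2 < 2k ≤ (ℓ + κ)N` with `2σ = ℓ + 2κ` forces `κN < 2`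
  have hσN : 2 * (σ * N) = ℓ * N + 2 * (κ * N) := by rw [hσ, hℓ]; ring
  nlinarith [hklt, hlog, hκN, hσN]

/-! ## 3. `LaserFloorStrict → LaserTangency` -/

/-- **Pointwise affine inequality from strictness.**  If points with `τ_F ≥ 2/s` lie `δ` above the
floor, then for `0 ≤ u ≤ δ` EVERY universal point satisfies
`(b_L − u) + (1/3 + s u/2)·τ_F ≤ x_F`. -/
theorem pointwise_of_strict {s δ : ℝ} (hs0 : 0 < s) (hs1 : s < 1)
    (hδ : ∀ F : SpectralMap ℂ, IsUniversalSpectralPoint ℂ F →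
      2 + (2 / s - 2) ≤ Real.logb 2 (F (matMulTensor ℂ 2 2 2)) →
        Real.logb 2 3 + (Real.logb 2 (F (matMulTensor ℂ 2 2 2)) - 2) / 3 + δ ≤
          Real.logb 2 (F (cwTensor ℂ 2)))
    {u : ℝ} (hu0 : 0 ≤ u) (huδ : u ≤ δ)
    {F : SpectralMap ℂ} (hF : IsUniversalSpectralPoint ℂ F) :
    (Real.logb 2 3 - 2 / 3 - u) + (1 / 3 + s * u / 2) * Real.logb 2 (F (matMulTensor ℂ 2 2 2)) ≤
      Real.logb 2 (F (cwTensor ℂ 2)) := by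
  set τ := Real.logb 2 (F (matMulTensor ℂ 2 2 2)) with hτ
  set x := Real.logb 2 (F (cwTensor ℂ 2)) with hx
  have hτ2 : 2 ≤ τ := two_le_matExp hF
  have hτ3 : τ ≤ 3 := matExp_le_three hF
  have hfloor : Real.logb 2 3 + (τ - 2) / 3 ≤ x := laserFloor hF
  have hsu : s * u ≤ u := mul_le_of_le_one_left hu0 hs1.le
  have e1 : (Real.logb 2 3 - 2 / 3 - u) + (1 / 3 + s * u / 2) * τ =
      Real.logb 2 3 + (τ - 2) / 3 - u + s * u / 2 * τ := by ring
  rw [e1]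
  by_cases hbig : 2 + (2 / s - 2) ≤ τ
  · have h := hδ F hF hbig
    have h1 : s * u / 2 * τ ≤ u / 2 * 3 := mul_le_mul (by linarith) hτ3 (by linarith) (by positivity)
    linarith
  · push Not at hbig
    have h1 : s * τ < 2 := by
      have h2 : s * τ < s * (2 + (2 / s - 2)) := mul_lt_mul_of_pos_left hbig hs0
      have e : s * (2 + (2 / s - 2)) = 2 := by field_simp; ring
      linarith
    have h2 : s * u / 2 * τ ≤ u := by
      rw [show s * u / 2 * τ = s * τ * u / 2 by ring]
      have := mul_le_mul_of_nonneg_right h1.le hu0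
      linarith
    linarith

/-- **`LaserFloorStrict → LaserTangency`** (the converse of the filed edge
`strict_of_laserTangency`).  See the module docstring, §3. -/
theorem laserTangency_of_strict (hS : LaserFloorStrict) : LaserTangency := by
  intro s hs0 hs1
  set b := Real.logb 2 3 - 2 / 3 with hb
  have hb0 : 0 < b := logb_two_three_sub_pos
  have hb43 : b < 4 / 3 := logb_two_three_sub_lt
  have e3 : Real.logb 2 3 = b + 2 / 3 := by rw [hb]; ring
  have hη : 0 < 2 / s - 2 := by
    have : 2 < 2 / s := by rw [lt_div_iff₀ hs0]; linarith
    linarith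
  obtain ⟨δ, hδ0, hδ⟩ := hS (2 / s - 2) hη
  set u := min δ (b / 2) with hu
  have hu0 : 0 < u := lt_min hδ0 (by linarith)
  have huδ : u ≤ δ := min_le_left _ _
  have hub : u ≤ b / 2 := min_le_right _ _
  refine ⟨b - u, by linarith, ?_⟩
  intro ε hε N₀
  have hpt : ∀ F : SpectralMap ℂ, IsUniversalSpectralPoint ℂ F →
      (b - u) + (1 / 3 + s * u / 2) * Real.logb 2 (F (matMulTensor ℂ 2 2 2)) ≤
        Real.logb 2 (F (cwTensor ℂ 2)) :=
    fun F hF => pointwise_of_strict hs0 hs1 hδ hu0.le huδ hF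
  -- the cell: level `N₁`, multiplicity exponent `β₁`, size exponent `k₁`
  obtain ⟨N₁, hN₁N₀, hN₁1, hN₁ε⟩ := exists_level N₀ hε 6
  have hc0 : 0 ≤ 1 / 3 + s * u / 2 := by positivity
  set β₁ := ⌊(b - u) * N₁⌋₊ with hβ₁
  set k₁ := ⌊(1 / 3 + s * u / 2) * N₁⌋₊ with hk₁
  have hβle : (β₁ : ℝ) ≤ (b - u) * N₁ := Nat.floor_le (mul_nonneg (by linarith) (Nat.cast_nonneg _))
  have hβlt : (b - u) * N₁ < β₁ + 1 := Nat.lt_floor_add_one _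
  have hkle : (k₁ : ℝ) ≤ (1 / 3 + s * u / 2) * N₁ := Nat.floor_le (by positivity)
  have hklt : (1 / 3 + s * u / 2) * N₁ < k₁ + 1 := Nat.lt_floor_add_one _
  -- spectral domination of the packing `⟨2^{β₁}⟩ ⊗ ⟨2^{k₁},2^{k₁},2^{k₁}⟩` by `cw₂^{⊠N₁}`
  have hdom : ∀ F : SpectralMap ℂ, IsUniversalSpectralPoint ℂ F →
      F (kroneckerTensor (unitTensor ℂ (2 ^ β₁))
          (matMulTensor ℂ (2 ^ k₁) (2 ^ k₁) (2 ^ k₁))) ≤ F (cwTensor ℂ 2) ^ N₁ := by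
    intro F hF
    set τ := Real.logb 2 (F (matMulTensor ℂ 2 2 2)) with hτ
    set x := Real.logb 2 (F (cwTensor ℂ 2)) with hx
    have hM : F (matMulTensor ℂ 2 2 2) = (2 : ℝ) ^ τ := map_matMulTensor_two_eq hF
    have hC : F (cwTensor ℂ 2) = (2 : ℝ) ^ x := map_cwTensor_eq hF
    have hτ0 : 0 ≤ τ := le_trans (by norm_num) (two_le_matExp hF)
    have hsl : (b - u) + (1 / 3 + s * u / 2) * τ ≤ x := hpt F hF
    have hexp : (β₁ : ℝ) + τ * k₁ ≤ x * N₁ := by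
      calc (β₁ : ℝ) + τ * k₁ ≤ (b - u) * N₁ + τ * ((1 / 3 + s * u / 2) * N₁) :=
            add_le_add hβle (mul_le_mul_of_nonneg_left hkle hτ0)
        _ = ((b - u) + (1 / 3 + s * u / 2) * τ) * N₁ := by ring
        _ ≤ x * N₁ := mul_le_mul_of_nonneg_right hsl (Nat.cast_nonneg N₁)
    rw [map_packing hF]
    push_cast
    calc (2 : ℝ) ^ β₁ * F (matMulTensor ℂ (2 ^ k₁) (2 ^ k₁) (2 ^ k₁))
        = (2 : ℝ) ^ β₁ * F (matMulTensor ℂ 2 2 2) ^ k₁ := by rw [map_matMulTensor_two_pow hF k₁]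
      _ = (2 : ℝ) ^ ((β₁ : ℝ) + τ * k₁) := by
          rw [Real.rpow_add two_pos, Real.rpow_natCast, hM, Real.rpow_mul zero_le_two,
            Real.rpow_natCast]
      _ ≤ (2 : ℝ) ^ (x * N₁) := Real.rpow_le_rpow_of_exponent_le one_le_two hexp
      _ = F (cwTensor ℂ 2) ^ N₁ := by rw [hC, Real.rpow_mul zero_le_two, Real.rpow_natCast]
  -- Strassen transfer, then a power `n` with `r n ≤ n`
  obtain ⟨r, hr, hres⟩ := restrictsTo_packing_of_spectral_le β₁ k₁ N₁ hdom
  obtain ⟨n, hn1, hrn⟩ := exists_le_self_of_isSubexponential hr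
  have hn0 : (0 : ℝ) ≤ n := Nat.cast_nonneg n
  have hn1' : (1 : ℝ) ≤ n := by exact_mod_cast hn1
  have hrn' : (r n : ℝ) ≤ n := by exact_mod_cast hrn
  have hr0 : (0 : ℝ) ≤ r n := Nat.cast_nonneg _
  refine ⟨N₁ * n + r n, ?_, 2 ^ (β₁ * n), 2 ^ (k₁ * n), hres n, ?_, ?_⟩
  · exact le_trans hN₁N₀ (le_trans (Nat.le_mul_of_pos_right N₁ hn1) (Nat.le_add_right _ _))
  · -- the multiplicity cap `B ≤ 2^{(b_L - u) N}`
    push_cast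
    rw [← Real.rpow_natCast]
    apply Real.rpow_le_rpow_of_exponent_le one_le_two
    push_cast
    have h1 : (β₁ : ℝ) * n ≤ (b - u) * N₁ * n := mul_le_mul_of_nonneg_right hβle hn0
    have h2 : 0 ≤ (b - u) * (r n : ℝ) := mul_nonneg (by linarith) hr0
    nlinarith [h1, h2]
  · -- the value `2^{((2/3)(1-s) - ε) N} 3^{s N} ≤ B^s m²`
    have eL : ∀ M : ℝ, (2 : ℝ) ^ ((2 / 3 * (1 - s) - ε) * M) * (3 : ℝ) ^ (s * M) =
        (2 : ℝ) ^ ((2 / 3 * (1 - s) - ε) * M + Real.logb 2 3 * (s * M)) := by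
      intro M
      have e : (3 : ℝ) ^ (s * M) = (2 : ℝ) ^ (Real.logb 2 3 * (s * M)) := by
        rw [Real.rpow_mul zero_le_two (Real.logb 2 3) (s * M),
          Real.rpow_logb two_pos (by norm_num) (by norm_num)]
      rw [e, ← Real.rpow_add two_pos]
    have eR : ((2 ^ (β₁ * n) : ℕ) : ℝ) ^ s * ((2 ^ (k₁ * n) : ℕ) : ℝ) ^ 2 =
        (2 : ℝ) ^ (((β₁ * n : ℕ) : ℝ) * s + ((k₁ * n : ℕ) : ℝ) * 2) := by
      rw [Real.rpow_add two_pos, Real.rpow_mul zero_le_two (((β₁ * n : ℕ) : ℝ)) s,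
        Real.rpow_mul zero_le_two (((k₁ * n : ℕ) : ℝ)) 2, Real.rpow_natCast, Real.rpow_natCast,
        Real.rpow_two]
      push_cast
      ring
    rw [eL, eR]
    apply Real.rpow_le_rpow_of_exponent_le one_le_two
    push_cast
    rw [e3]
    have hsb : s * b ≤ b := mul_le_of_le_one_left hb0.le hs1.le
    have hβn : s * (((b - u) * N₁ - 1) * n) ≤ s * (β₁ * n) :=
      mul_le_mul_of_nonneg_left (mul_le_mul_of_nonneg_right (by linarith) hn0) hs0.le
    have hkn : 2 * (((1 / 3 + s * u / 2) * N₁ - 1) * n) ≤ 2 * (k₁ * n) :=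
      mul_le_mul_of_nonneg_left (mul_le_mul_of_nonneg_right (by linarith) hn0) (by norm_num)
    have hεn : 6 * (n : ℝ) ≤ ε * N₁ * n := mul_le_mul_of_nonneg_right hN₁ε hn0
    have hsbR : s * b * (r n : ℝ) ≤ 4 / 3 * r n :=
      mul_le_mul_of_nonneg_right (hsb.trans hb43.le) hr0
    have hεR : 0 ≤ ε * (r n : ℝ) := mul_nonneg hε.le hr0
    have hsn : s * (n : ℝ) ≤ n := mul_le_of_le_one_left hn0 hs1.le
    nlinarith [hβn, hkn, hεn, hsbR, hεR, hsn, hrn', hn1']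

/-! ## 4. The equivalences, and the route items by name -/

/-- `LaserTangency ⟺ LaserFloorStrict`: the attacked crux of the cut of record IS the statement
«the pair-spectrum meets the laser floor line only at the gauge corner». -/
theorem laserTangency_iff_strict : LaserTangency ↔ LaserFloorStrict :=
  ⟨strict_of_laserTangency, laserTangency_of_strict⟩

/-- `LaserMergeOptimal ⟺ LaserTightAtTop`: the residual crux of the cut of record IS the
statement «the pair-spectrum meets the laser floor line at the top corner». -/
theorem laserMergeOptimal_iff_tightAtTop : LaserMergeOptimal ↔ LaserTightAtTop :=
  ⟨tightAtTop_of_laserMergeOptimal, laserMergeOptimal_of_tightAtTop⟩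

/-! ## Route item `LaserCutIsSpectral` by name -/

/-- Item `LaserCutIsSpectral` holds: the cut of record, letter for letter on Strassen's spectrum —
`(LaserTangency ↔ LaserFloorStrict) ∧ (LaserMergeOptimal ↔ LaserTightAtTop)`. -/
theorem laserCutIsSpectral_holds :
    Summit.MatrixMultiplication.MatrixMultiplication.Theses.OutsiderSandwich.LaserCutIsSpectral :=
  ⟨laserTangency_iff_strict, laserMergeOptimal_iff_tightAtTop⟩

end Summit.MatrixMultiplication.MatrixMultiplication.Theorems.OutsiderSandwichSpectralConverse
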